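import Literature.Probability.Percolation.BoxCrossing
import Literature.Probability.Percolation.SiteMonotonicity
import HarnessLib

/-!
# `p_c^site(𝕋) = 1/2`: reduction to `θ(1/2) = 0` and `θ > 0` above `1/2`

Topic `Literature/Probability/Percolation`. Assembly layer of the discharge of the named fact
`Literature.Probability.Percolation.triCriticalProb_eq_half` (`BoxCrossing.lean`; Kesten, *Percolation theory for
mathematicians* (1982), §3.4, Application (i), eq. (3.67), pp. 52–53: for the one-parameter
site problem on a triangulated periodic planar graph with a symmetry axis, in particular for
site percolation on the triangular lattice, `p_T = p_S = p_H = 1/2`).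

Kesten's proof of (3.67) (p. 53): `𝕋` is self-matching, so Condition A of Thm. 3.1 holds
trivially at `p₀ = 1/2` ((3.68)), and then "by (3.43), (3.46) and (3.49) percolation occurs under
`P_p` iff `p > 1/2`", i.e.

* (3.43)/(3.46): `θ(p) = 0` for `p ≤ 1/2` — given `θ(1/2) = 0` (the named fact
  `Literature.Probability.Percolation.triTheta_half`) this is the monotonicity of `θ`
  (`Literature.Probability.Percolation.triTheta_mono`, proved in `SiteMonotonicity.lean`);
* (3.49): `θ(p) > 0` for `p > 1/2` — taken here as a hypothesis
  `∀ p, 1/2 < p → 0 < θ(p)`, and proved in `TriSharpness.lean` (Hex lemma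
  `half_le_triLRCrossingProb_self` of `TriHexLemma.lean`, the Duminil-Copin–Tassion sharpness
  argument in its site version, and a union bound; cf. Bollobás–Riordan 2006, Ch. 5, Thm. 8).

Since `p_H = sup {p : θ(p) = 0}` (Kesten (3.62)) and our
`triCriticalProb = inf ({p | θ(p) > 0} ∪ {1})` (`Literature.Probability.Percolation.siteCriticalProb`), the two inputs
give `triCriticalProb = 1/2` (`triCriticalProb_eq_half_of`). The generic order-theoretic steps
are `siteCriticalProb_le_of_siteTheta_pos`, `le_siteCriticalProb_of_forall` and
`siteCriticalProb_le_of_forall_gt`.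

## References

* H. Kesten, *Percolation theory for mathematicians*, Birkhäuser 1982, §3.4, Application (i),
  (3.62), (3.67)–(3.68), pp. 52–53 [KestenPTM1982].
* B. Bollobás, O. Riordan, *Percolation*, CUP 2006, Ch. 5, Thm. 8.

## Mathlib / tree

Mathlib: `csInf_le`, `le_csInf`, `le_of_forall_gt_imp_ge_of_dense`. Tree: `siteCriticalProb`,
`siteTheta` (`Percolation.lean`), `triCriticalProb`, `triTheta` (`TriangularLattice.lean`),
`triCriticalProb_eq_half`, `triTheta_half` (`BoxCrossing.lean`), `triTheta_mono`
(`SiteMonotonicity.lean`); the bond-`ℤ²` analogue of this reduction is `KestenTheorem.lean`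
(`half_le_criticalProb_Z2`, `criticalProb_Z2_le_half`), which we follow.
-/

namespace Literature.Probability.Percolation

open MeasureTheory LatticeModels

noncomputable section

/-! ### Generic bounds on `p_c^site` -/

variable {V : Type*}

/-- If `θ_x(p) > 0` then `p_c^site ≤ p` (`p_c^site` is the infimum of such `p`). [folklore] -/
theorem siteCriticalProb_le_of_siteTheta_pos (G : SimpleGraph V) (x : V) {p : unitInterval}
    (h : 0 < siteTheta G x p) : siteCriticalProb G x ≤ p := by
  have h0 : ∀ r ∈ ({r : ℝ | ∃ h : r ∈ unitInterval, 0 < siteTheta G x ⟨r, h⟩} ∪ {1}),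
      (0 : ℝ) ≤ r := by
    rintro r (⟨hr, -⟩ | hr)
    · exact hr.1
    · rw [Set.mem_singleton_iff] at hr
      rw [hr]; exact zero_le_one
  exact csInf_le ⟨0, h0⟩ (Or.inl ⟨p.2, h⟩)

/-- If every `p` with `θ_x(p) > 0` satisfies `a ≤ p`, and `a ≤ 1`, then `a ≤ p_c^site`. [folklore] -/
theorem le_siteCriticalProb_of_forall (G : SimpleGraph V) (x : V) {a : ℝ} (ha : a ≤ 1)
    (h : ∀ p : unitInterval, 0 < siteTheta G x p → a ≤ p) : a ≤ siteCriticalProb G x := by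
  refine le_csInf ⟨1, Or.inr rfl⟩ ?_
  rintro r (⟨hr, hθ⟩ | hr)
  · exact h ⟨r, hr⟩ hθ
  · rw [Set.mem_singleton_iff] at hr
    rwa [hr]

/-- If `θ_x(q) > 0` for all `q ∈ (a, 1]` (with `0 ≤ a`), then `p_c^site ≤ a`. [folklore] -/
theorem siteCriticalProb_le_of_forall_gt (G : SimpleGraph V) (x : V) {a : ℝ} (ha : 0 ≤ a)
    (h : ∀ q : unitInterval, a < q → 0 < siteTheta G x q) : siteCriticalProb G x ≤ a := by
  refine le_of_forall_gt_imp_ge_of_dense fun q hq => ?_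
  rcases le_or_gt q 1 with hq1 | hq1
  · have hq01 : q ∈ unitInterval := ⟨ha.trans hq.le, hq1⟩
    exact siteCriticalProb_le_of_siteTheta_pos G x (p := ⟨q, hq01⟩) (h ⟨q, hq01⟩ hq)
  · exact (siteCriticalProb_mem_Icc G x).2.trans hq1.le

/-! ### `p_c^site(𝕋) = 1/2` from the two inputs -/

/-- **`p_c^site(𝕋) ≥ 1/2` from `θ(1/2) = 0`** (Kesten 1982, §3.4, (3.43)/(3.46) with (3.62)
`p_H = sup {p : θ(p) = 0}`): `θ` is non-decreasing (`triTheta_mono`), so `θ(p) = 0` for all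
`p ≤ 1/2`, and every `p` with `θ(p) > 0` exceeds `1/2`. [cite: KestenPTM1982, §3.4 (3.62), (3.67)] -/
theorem half_le_triCriticalProb_of (h0 : triTheta_half) : (1 / 2 : ℝ) ≤ triCriticalProb := by
  refine le_siteCriticalProb_of_forall triGraph 0 (by norm_num) fun p hp => ?_
  by_contra hlt
  rw [not_le] at hlt
  have hle : p ≤ half := by
    change (p : ℝ) ≤ (1 / 2 : ℝ)
    exact hlt.le
  have hmono := triTheta_mono hle
  have h0' : triTheta half = 0 := h0
  rw [h0'] at hmono
  exact absurd hmono (not_le.2 hp)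

/-- **`p_c^site(𝕋) ≤ 1/2` from `θ > 0` on `(1/2, 1]`** (Kesten 1982, §3.4, (3.49) and (3.67):
"percolation occurs under `P_p` iff `p > 1/2`", the `if` direction as hypothesis): every
`q ∈ (1/2, 1]` bounds the infimum `p_c^site` from above. [cite: KestenPTM1982, §3.4 (3.67)] -/
theorem triCriticalProb_le_half_of (h : ∀ p : unitInterval, (1 / 2 : ℝ) < p → 0 < triTheta p) :
    triCriticalProb ≤ (1 / 2 : ℝ) :=
  siteCriticalProb_le_of_forall_gt triGraph 0 (by norm_num) h

/-- **Assembly** (Kesten 1982, §3.4, Application (i), (3.67): `p_H(site, 𝕋) = 1/2`): the named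
fact `triCriticalProb_eq_half` follows from `θ(1/2) = 0` (`triTheta_half`, Kesten (3.43)) and
`θ(p) > 0` for `p > 1/2` (Kesten (3.49); proved in `TriSharpness.lean`), the monotonicity of `θ`
being proved. [cite: KestenPTM1982, §3.4 Application (i), (3.67), pp. 52–53] -/
theorem triCriticalProb_eq_half_of (h0 : triTheta_half)
    (h : ∀ p : unitInterval, (1 / 2 : ℝ) < p → 0 < triTheta p) : triCriticalProb_eq_half :=
  le_antisymm (triCriticalProb_le_half_of h) (half_le_triCriticalProb_of h0)

end

end Literature.Probability.Percolation
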